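import Summits.CriticalPhenomena.CardyFormulaZ2.Theorems.CardyBoundaryCoulombGasBoundaryDefectGaussianRStubClusterLocalityV2Part4

/-!
# Stub `stub_clusterLocalityV2` of line `rainbow-monomials-in-excursion-kernels` — Part 5:
# the dipole lower bound `G(x, y) ≥ c/(|x - y| + 1)²` for two points of a flat boundary row
# (crux `BoundaryDefectGaussianR`, stmt-CriticalPhenomena-14132)

Step (C) of the Green-locality half G1 of `stub_clusterLocalityV2`: for two points `x, y` of the
bottom row of the half-rectangle `Q = {|v₀ - x₀| ≤ 817k, x₁ ≤ v₁ ≤ x₁ + 816k}` with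
`|x₀ - y₀| ≤ k` (`k ≥ 1`),

  `G_Q(x, y) ≥ c₁/(50k + 1)²`,  `c₁ = (15/152)·(c_*/2)¹⁸`,

`c_* = maneuverConst` the universal constant of the tree's one-scale Harnack inequality
(`dirichletGreen_row_lower`; registered sub-goal `s10_greenRowLower`; by monotonicity the same
bound holds in every finite `V ⊇ Q`, `dirichletGreen_row_lower_of_subset`). This is the lattice
dipole–dipole order `|x - y|⁻²` of the excursion Poisson kernel, up to constants. Proof:
`f = G_Q(·, y)` is nonnegative and harmonic on the hole-free `Q ∖ {y}` (Part 4);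
(i) on the axis above `y` at height `50k`, `f ≥ hpPoisson - 2/(816k+1) ≥ 1/(8(50k+1))`
(Part 2: comparison with the half-plane kernel, the tree's `hpK s 0 ≥ 1/(4s)`);
(ii) a Harnack chain of `≤ 17` boxes of radius `12k` along the row at height `50k`
(`harnack_one_scale`, boxes of radius `48k` inside `Q ∖ {y}`) spreads this to
`f ≥ (c_*/2)¹⁸/(8(50k+1))` on the whole top side of the wide rectangle
`R = {|v₀ - x₀| ≤ 200k - 1, x₁ ≤ v₁ ≤ x₁ + 50k - 1}`;
(iii) Green's representation of `f` on `R` from `x` and the top-side harmonic measure bound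
`≥ (15/19)/(50k+1)` of Part 4 give the claim.

All statements are folklore (Lawler–Limic 2010, §6.2–6.3, §8.1).
-/

noncomputable section

namespace Summit.CriticalPhenomena.CardyFormulaZ2.Cruxes.BoundaryDefectGaussianR.RainbowMonomialsInExcursionKernels

open Finset Literature.Probability.LatticeModels

/-! ### A Harnack chain -/

/-- **Harnack chain**: iterating the tree's one-scale Harnack inequality along centres
`d 0, d 1, …`, each in the start box of the previous one and with its region inside `U`, gives
`f (d j) ≥ (c_*/2)^j f (d 0)`. [folklore] -/
theorem harnack_chain {U : Set (Site 2)} (hU : U.Finite) (hUh : HoleFree U) {f : Site 2 → ℝ}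
    (hf : IsLatticeHarmonicOn f U) (hpos : ∀ w ∈ U ∪ latticeOuterBoundary U, 0 ≤ f w)
    {k : ℕ} (hk : 0 < k) (d : ℕ → Site 2) {J : ℕ}
    (hW : ∀ j, j < J → mW (d j) k ⊆ U) (hB : ∀ j, j < J → d (j + 1) ∈ mB (d j) k) :
    ∀ j, j ≤ J → (maneuverConst / 2) ^ j * f (d 0) ≤ f (d j) := by
  intro j
  induction j with
  | zero => intro _; simp
  | succ j ih =>
    intro hj
    have h1 := ih (by omega)
    have h2 := harnack_one_scale hU hUh hf hpos hk (hW j (by omega)) (hB j (by omega))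
    have hA : 0 ≤ maneuverConst / 2 := by have := maneuverConst_pos; positivity
    calc (maneuverConst / 2) ^ (j + 1) * f (d 0)
        = (maneuverConst / 2) * ((maneuverConst / 2) ^ j * f (d 0)) := by ring
      _ ≤ (maneuverConst / 2) * f (d j) := mul_le_mul_of_nonneg_left h1 hA
      _ ≤ f (d (j + 1)) := h2

/-! ### (C) The dipole lower bound on a flat boundary row -/

/-- **(C) Dipole lower bound.** For `k ≥ 1`, the half-rectangle
`Q = {|v₀ - x₀| ≤ 817k, x₁ ≤ v₁ ≤ x₁ + 816k}` and a point `y` of its bottom row with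
`|x₀ - y₀| ≤ k`: `G_Q(x, y) ≥ (15/152)(c_*/2)¹⁸/(50k+1)²`. [folklore] -/
theorem dirichletGreen_row_lower {Q : Finset (Site 2)} {x y : Site 2} {k : ℕ} (hk : 1 ≤ k)
    (hQ : ∀ v : Site 2, v ∈ Q ↔ (x 0 - (817 * k : ℕ) ≤ v 0 ∧ v 0 ≤ x 0 + (817 * k : ℕ)) ∧
      (x 1 ≤ v 1 ∧ v 1 ≤ x 1 + (816 * k : ℕ)))
    (hy1 : y 1 = x 1) (hxy : |x 0 - y 0| ≤ k) :
    15 / 152 * (maneuverConst / 2) ^ 18 / (50 * (k : ℝ) + 1) ^ 2 ≤ dirichletGreen Q x y := by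
  have hd : 0 < 2 := by norm_num
  have hk0 : (0 : ℤ) < k := by exact_mod_cast hk
  have hkr : (1 : ℝ) ≤ k := by exact_mod_cast hk
  have hxy' := abs_le.1 hxy
  set A : ℝ := maneuverConst / 2 with hA
  have hA0 : 0 < A := by have := maneuverConst_pos; positivity
  have hA1 : A ≤ 1 := by have := maneuverConst_le_one; rw [hA]; linarith
  have hyQ : y ∈ Q := by rw [hQ]; omega
  -- `f = G_Q(·, y)`, nonnegative, harmonic on the hole-free `U = Q ∖ {y}`
  set f : Site 2 → ℝ := fun v => dirichletGreen Q v y with hfdef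
  have f_eq : f = dirichletGreen Q y := by funext v; exact dirichletGreen_comm Q v y
  have f_nonneg : ∀ v, 0 ≤ f v := fun v => dirichletGreen_nonneg hd Q v y
  set U : Set (Site 2) := ↑(Q.erase y) with hUdef
  have hUfin : U.Finite := (Q.erase y).finite_toSet
  have hUmem : ∀ v, v ∈ U ↔ v ≠ y ∧ ((x 0 - (817 * k : ℕ) ≤ v 0 ∧ v 0 ≤ x 0 + (817 * k : ℕ)) ∧
      (x 1 ≤ v 1 ∧ v 1 ≤ x 1 + (816 * k : ℕ))) := fun v => by
    rw [hUdef, Finset.mem_coe, Finset.mem_erase, hQ]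
  have hUh : HoleFree U := holeFree_halfRect_erase hQ hy1
  have hf : IsLatticeHarmonicOn f U := by
    intro v hv
    rw [latticeLaplacian_eq_latticeLaplacianZd, f_eq]
    have hv' := Finset.mem_erase.1 (Finset.mem_coe.1 hv)
    have := neg_latticeLaplacianZd_dirichletGreen hd Q y hv'.2
    rw [if_neg (Ne.symm hv'.1)] at this
    linarith
  have hpos : ∀ w ∈ U ∪ latticeOuterBoundary U, 0 ≤ f w := fun w _ => f_nonneg w
  -- the centres of the chain: `c t = (y₀ + 12kt, y₁ + 50k)`
  set c : ℤ → Site 2 := fun t => ![y 0 + 12 * k * t, y 1 + 50 * k] with hcdef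
  have hc0 : ∀ t, c t 0 = y 0 + 12 * k * t := fun t => by simp [hcdef]
  have hc1 : ∀ t, c t 1 = y 1 + 50 * k := fun t => by simp [hcdef]
  -- Step 1: the axis value `f (c 0) ≥ 1/(8(50k+1))`
  have haxis : 1 / (8 * (50 * (k : ℝ) + 1)) ≤ f (c 0) := by
    have hΛ : ∀ v ∈ Q, y 1 ≤ v 1 := fun v hv => by rw [hQ] at hv; omega
    have hB : ∀ z ∈ outerBoundary (zdGraph 2) Q, y 1 ≤ z 1 →
        hpPoisson (z - y) ≤ 2 / ((816 * k + 1 : ℕ) : ℝ) := by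
      intro z hz hz1
      refine hpPoisson_le_two_div_of_rim (N := 816 * k + 1) (by omega) ?_
      simp only [Pi.sub_apply]
      rcases outerBoundary_halfRect hQ hz with h | h | h
      · omega
      · right; push_cast; omega
      · left
        refine ⟨?_, by omega, by push_cast; omega⟩
        rcases h.1 with h0 | h0
        · rw [abs_of_nonpos (by omega)]; push_cast; omega
        · rw [abs_of_nonneg (by omega)]; push_cast; omega
    have hc0Q : c 0 ∈ Q := by rw [hQ, hc0, hc1]; omega
    have hlow := hpPoisson_sub_le_dirichletGreen hΛ (by positivity) hB hc0Q
    have hax := hpPoisson_axis_ge (c 0 - y) (by simp [hc0]) (by simp [hc1])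
    have hv1 : (((c 0 - y) 1 : ℤ) : ℝ) = 50 * k := by simp [hc1]
    rw [hv1] at hax
    have hcmp : 2 / ((816 * k + 1 : ℕ) : ℝ) ≤ 1 / (8 * (50 * (k : ℝ) + 1)) := by
      rw [div_le_div_iff₀ (by positivity) (by positivity)]
      push_cast; nlinarith
    have e : 1 / (4 * (50 * (k : ℝ) + 1)) = 2 * (1 / (8 * (50 * (k : ℝ) + 1))) := by
      field_simp; ring
    have : hpPoisson (c 0 - y) - 2 / ((816 * k + 1 : ℕ) : ℝ) ≤ f (c 0) := hlow
    linarith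
  -- Step 2: the regions of the chain lie in `U`, consecutive centres are in each other's boxes
  have hkpos : 0 < k := hk
  have hWt : ∀ t : ℤ, |t| ≤ 17 → mW (c t) k ⊆ U := by
    intro t ht v hv
    simp only [mW, Set.mem_setOf_eq, hc0, hc1, abs_le] at hv
    have ht' := abs_le.1 ht
    have h1 : -(204 * (k : ℤ)) ≤ 12 * k * t := by nlinarith
    have h2 : 12 * k * t ≤ 204 * (k : ℤ) := by nlinarith
    rw [hUmem]
    refine ⟨?_, ?_⟩
    · rintro rfl; omega
    · push_cast; omega
  have hBt : ∀ t : ℤ, c (t + 1) ∈ mB (c t) k ∧ c (t - 1) ∈ mB (c t) k := by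
    intro t
    simp only [mB, Set.mem_setOf_eq, hc0, hc1]
    have e1 : y 0 + 12 * (k : ℤ) * (t + 1) - (y 0 + 12 * k * t) = 12 * k := by ring
    have e2 : y 0 + 12 * (k : ℤ) * (t - 1) - (y 0 + 12 * k * t) = -(12 * k) := by ring
    rw [e1, e2, sub_self, abs_neg, abs_of_nonneg (by positivity), abs_zero]
    exact ⟨⟨le_rfl, by positivity⟩, ⟨le_rfl, by positivity⟩⟩
  -- the chain in both directions: `f (c t) ≥ A^17 f (c 0)` for `|t| ≤ 17`
  have hchain : ∀ t : ℤ, |t| ≤ 17 → A ^ 17 * f (c 0) ≤ f (c t) := by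
    have hR := harnack_chain hUfin hUh hf hpos hkpos (fun j : ℕ => c j) (J := 17)
      (fun j hj => hWt j (by rw [abs_of_nonneg (by positivity)]; exact_mod_cast hj.le))
      (fun j _ => by have := (hBt j).1; push_cast; exact this)
    have hL := harnack_chain hUfin hUh hf hpos hkpos (fun j : ℕ => c (-j)) (J := 17)
      (fun j hj => hWt (-j) (by rw [abs_neg, abs_of_nonneg (by positivity)]; exact_mod_cast hj.le))
      (fun j _ => by
        have := (hBt (-j)).2
        have e : -((j : ℤ)) - 1 = -(((j + 1 : ℕ) : ℤ)) := by push_cast; ring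
        rw [e] at this; exact this)
    intro t ht
    have hf0 := f_nonneg (c 0)
    have hmono : ∀ n : ℕ, n ≤ 17 → A ^ 17 ≤ A ^ n := fun n hn =>
      pow_le_pow_of_le_one hA0.le hA1 hn
    rcases Int.eq_nat_or_neg t with ⟨n, rfl | rfl⟩
    · have hn : n ≤ 17 := by
        rw [abs_of_nonneg (by positivity)] at ht; exact_mod_cast ht
      have h := hR n hn
      simp only [Nat.cast_zero] at h
      calc A ^ 17 * f (c 0) ≤ A ^ n * f (c 0) := mul_le_mul_of_nonneg_right (hmono n hn) hf0
        _ ≤ f (c n) := h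
    · have hn : n ≤ 17 := by
        rw [abs_neg, abs_of_nonneg (by positivity)] at ht; exact_mod_cast ht
      have h := hL n hn
      simp only [Nat.cast_zero, neg_zero] at h
      calc A ^ 17 * f (c 0) ≤ A ^ n * f (c 0) := mul_le_mul_of_nonneg_right (hmono n hn) hf0
        _ ≤ f (c (-n)) := h
  -- one more Harnack step: `f ≥ A^18 f(c 0)` on the whole row segment at height `50k`
  have hrow : ∀ z : Site 2, z 1 = y 1 + 50 * k → x 0 - (200 * k - 1 : ℕ) ≤ z 0 →
      z 0 ≤ x 0 + (200 * k - 1 : ℕ) → A ^ 18 * f (c 0) ≤ f z := by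
    intro z hz1 hz0 hz0'
    -- the index of the box containing `z`
    set a : ℤ := z 0 - y 0 + 204 * k with hadef
    have ha0 : 0 ≤ a := by omega
    have ha1 : a < 34 * (12 * k) := by omega
    have hqr := Int.mul_ediv_add_emod a (12 * k)
    have hr0 := Int.emod_nonneg a (show (12 * (k : ℤ)) ≠ 0 by positivity)
    have hr1 := Int.emod_lt_of_pos a (show (0 : ℤ) < 12 * k by positivity)
    have hq0 : 0 ≤ a / (12 * k) := Int.ediv_nonneg ha0 (by positivity)
    have hq1 : a / (12 * k) < 34 := (Int.ediv_lt_iff_lt_mul (by positivity)).2 ha1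
    set q : ℤ := a / (12 * k) with hqdef
    set t : ℤ := q - 17 with htdef
    have ht : |t| ≤ 17 := by rw [abs_le]; omega
    have hzB : z ∈ mB (c t) k := by
      simp only [mB, Set.mem_setOf_eq, hc0, hc1, hz1, sub_self, abs_zero]
      refine ⟨?_, by positivity⟩
      have e : y 0 + 12 * (k : ℤ) * t = y 0 + 12 * k * q - 204 * k := by rw [htdef]; ring
      rw [e, abs_le]
      constructor <;> omega
    have h1 := harnack_one_scale hUfin hUh hf hpos hkpos (hWt t ht) hzB
    have h2 := hchain t ht
    calc A ^ 18 * f (c 0) = A * (A ^ 17 * f (c 0)) := by ring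
      _ ≤ A * f (c t) := mul_le_mul_of_nonneg_left h2 hA0.le
      _ ≤ f z := h1
  -- Step 3: Green's representation on the wide rectangle `R` from `x`
  obtain ⟨R, hR⟩ := exists_halfRect x (200 * k - 1) (50 * k - 1)
  have hnT : ((200 * k - 1 : ℕ) : ℤ) + 1 = 4 * (((50 * k - 1 : ℕ) : ℤ) + 1) := by omega
  have hRQ : R ⊆ Q := fun v hv => by rw [hR] at hv; rw [hQ]; omega
  have hxR : x ∈ R := self_mem_halfRect hR
  have hrep := green_representation hd R f hxR
  have hvol : 0 ≤ ∑ v ∈ R, dirichletGreen R x v * (-latticeLaplacianZd f v) := by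
    refine Finset.sum_nonneg fun v hv => mul_nonneg (dirichletGreen_nonneg hd R x v) ?_
    rw [f_eq, neg_latticeLaplacianZd_dirichletGreen hd Q y (hRQ hv)]
    split_ifs <;> norm_num
  have htop := sum_poissonKernel_top_ge hR hnT
  have hT2 : (((50 * k - 1 : ℕ) : ℝ) + 2) = 50 * (k : ℝ) + 1 := by
    have : (1 : ℕ) ≤ 50 * k := by omega
    rw [Nat.cast_sub this]; push_cast; ring
  rw [hT2] at htop
  -- the boundary sum is at least the top-row part times the row bound
  have hbd : (A ^ 18 * f (c 0)) * ∑ z ∈ (outerBoundary (zdGraph 2) R).filter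
      (fun z => z 1 = x 1 + (50 * k - 1 : ℕ) + 1), poissonKernel R x z ≤
      ∑ z ∈ outerBoundary (zdGraph 2) R, poissonKernel R x z * f z := by
    rw [Finset.mul_sum]
    calc ∑ z ∈ (outerBoundary (zdGraph 2) R).filter (fun z => z 1 = x 1 + (50 * k - 1 : ℕ) + 1),
          A ^ 18 * f (c 0) * poissonKernel R x z
        ≤ ∑ z ∈ (outerBoundary (zdGraph 2) R).filter (fun z => z 1 = x 1 + (50 * k - 1 : ℕ) + 1),
          poissonKernel R x z * f z := by
          refine Finset.sum_le_sum fun z hz => ?_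
          rw [Finset.mem_filter] at hz
          have hfz := hrow z (by rw [hz.2, hy1]; omega)
            (by rcases outerBoundary_halfRect hR hz.1 with h | h | h <;> omega)
            (by rcases outerBoundary_halfRect hR hz.1 with h | h | h <;> omega)
          rw [mul_comm]
          exact mul_le_mul_of_nonneg_left hfz (poissonKernel_nonneg hd R x z)
      _ ≤ ∑ z ∈ outerBoundary (zdGraph 2) R, poissonKernel R x z * f z :=
          Finset.sum_le_sum_of_subset_of_nonneg (Finset.filter_subset _ _) fun z _ _ =>
            mul_nonneg (poissonKernel_nonneg hd R x z) (f_nonneg z)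
  -- assemble
  have hsum0 : 0 ≤ ∑ z ∈ (outerBoundary (zdGraph 2) R).filter
      (fun z => z 1 = x 1 + (50 * k - 1 : ℕ) + 1), poissonKernel R x z :=
    Finset.sum_nonneg fun z _ => poissonKernel_nonneg hd R x z
  have hk50 : (0 : ℝ) < 50 * (k : ℝ) + 1 := by positivity
  have hfin : A ^ 18 * (1 / (8 * (50 * (k : ℝ) + 1))) * (15 / 19 / (50 * (k : ℝ) + 1)) ≤ f x := by
    calc A ^ 18 * (1 / (8 * (50 * (k : ℝ) + 1))) * (15 / 19 / (50 * (k : ℝ) + 1))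
        ≤ (A ^ 18 * f (c 0)) * ∑ z ∈ (outerBoundary (zdGraph 2) R).filter
            (fun z => z 1 = x 1 + (50 * k - 1 : ℕ) + 1), poissonKernel R x z := by
          refine mul_le_mul ?_ htop (by positivity) ?_
          · exact mul_le_mul_of_nonneg_left haxis (by positivity)
          · exact mul_nonneg (by positivity) (f_nonneg _)
      _ ≤ ∑ z ∈ outerBoundary (zdGraph 2) R, poissonKernel R x z * f z := hbd
      _ ≤ f x := by rw [hrep]; linarith
  have e : 15 / 152 * A ^ 18 / (50 * (k : ℝ) + 1) ^ 2 =
      A ^ 18 * (1 / (8 * (50 * (k : ℝ) + 1))) * (15 / 19 / (50 * (k : ℝ) + 1)) := by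
    field_simp; ring
  rw [e]
  exact hfin

/-- **(C) in any larger domain**: if the finite `V` contains the half-rectangle
`{|v₀ - x₀| ≤ 817k, x₁ ≤ v₁ ≤ x₁ + 816k}` and `y` lies on the row of `x` with `|x₀ - y₀| ≤ k`
(`k ≥ 1`), then `G_V(x, y) ≥ (15/152)(c_*/2)¹⁸/(50k+1)²` (domain monotonicity). [folklore] -/
theorem dirichletGreen_row_lower_of_subset {V : Finset (Site 2)} {x y : Site 2} {k : ℕ}
    (hk : 1 ≤ k)
    (hV : ∀ v : Site 2, x 0 - 817 * k ≤ v 0 → v 0 ≤ x 0 + 817 * k → x 1 ≤ v 1 →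
      v 1 ≤ x 1 + 816 * k → v ∈ V)
    (hy1 : y 1 = x 1) (hxy : |x 0 - y 0| ≤ k) :
    15 / 152 * (maneuverConst / 2) ^ 18 / (50 * (k : ℝ) + 1) ^ 2 ≤ dirichletGreen V x y := by
  obtain ⟨Q, hQ⟩ := exists_halfRect x (817 * k) (816 * k)
  have hQV : Q ⊆ V := fun v hv => by
    rw [hQ] at hv; push_cast at hv; exact hV v hv.1.1 hv.1.2 hv.2.1 hv.2.2
  exact (dirichletGreen_row_lower hk hQ hy1 hxy).trans
    (dirichletGreen_mono (by norm_num) hQV x y)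

/-! ### Registered sub-goal of the stub carried by this file -/

/-- **Sub-goal `s10_greenRowLower`** (registered on stmt-CriticalPhenomena-14132; step (C) of
the Green-locality half G1 of `stub_clusterLocalityV2`): the dipole lower bound
`G_V(x, y) ≥ (15/152)(c_*/2)¹⁸/(50k+1)²` for two points of a flat boundary row at distance
`≤ k`, in every finite `V` containing the half-rectangle `{|v₀ - x₀| ≤ 817k, x₁ ≤ v₁ ≤ x₁ + 816k}`
(`dirichletGreen_row_lower_of_subset`). [folklore] -/
theorem s10_greenRowLower : ∀ (V : Finset (Literature.Probability.LatticeModels.Site 2)) (x y : Literature.Probability.LatticeModels.Site 2) (k : ℕ), 1 ≤ k → (∀ v : Literature.Probability.LatticeModels.Site 2, x 0 - 817 * k ≤ v 0 → v 0 ≤ x 0 + 817 * k → x 1 ≤ v 1 → v 1 ≤ x 1 + 816 * k → v ∈ V) → y 1 = x 1 → |x 0 - y 0| ≤ k → 15 / 152 * (Literature.Probability.LatticeModels.maneuverConst / 2) ^ 18 / (50 * (k : ℝ) + 1) ^ 2 ≤ Literature.Probability.LatticeModels.dirichletGreen V x y :=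
  fun _ _ _ _ hk hV hy1 hxy => dirichletGreen_row_lower_of_subset hk hV hy1 hxy

end Summit.CriticalPhenomena.CardyFormulaZ2.Cruxes.BoundaryDefectGaussianR.RainbowMonomialsInExcursionKernels

end
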